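import Summits.ResolutionOfSingularities.ResolutionOfSingularities.Theses.MaxContactCut
import Summits.ResolutionOfSingularities.ResolutionOfSingularities.Theorems.PurityValveClasses
import Summits.ResolutionOfSingularities.ResolutionOfSingularities.Theorems.MaxContactCutForcedTowers
import Summits.ResolutionOfSingularities.ResolutionOfSingularities.Theorems.MaxContactCutTauLadder
import Summits.ResolutionOfSingularities.ResolutionOfSingularities.Theorems.MaxContactCutFedderCut
import HarnessLib

/-!
# MaxContactCutPurityValve — the g9 node «PurityValve» wired to the route MaxContactCut BY NAME
(decomp-res node N49, lens-6 g9 sha256 dd3d1f175e2a2a66; CRITIC-LEDGER row 59 CLEARED; phase 3)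

Vocabulary: `Theorems/PurityValveClasses` (phase 1: core points, `AllCorePure`, the exact cuts `WORPure n` /
`WORImpure n` / `Purification n` of `ForcedTowerClasses.WOR n`, the valve `PureForwardClosed n` PROVED for `n ≥ 3`
from the costume ports `CartierLift` / `NearPointLift n`, the composition `seqAppend`, the certificates
`zariski_bound` / `centre_bound`).  Route asides (MaxContactCut rev 15, `aside · rank 9`, refining `RungOne` 29273
and the PURE-LOW₄ slice 30702): `PVPureGame` (`∀ n ≥ 1, WORPure n`) [UNDECIDED · IDEA-NEEDED + INSTRUMENTABLE ·
WEAKER], `PVPurification` (`∀ n ≥ 1, Purification n`) [located residual, score 0].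

Kernels (all by name, 0 sorry):
* `PVPurification → PVPureGame → E 1` (purify, then play the pure game; composition of centre sequences), hence
  `RungOne` (29273) via the landed `MaxContactCutForcedTowers.rungOne_of_e_one`;
* EXACT at the rung modulo the costume `BaseStable`: `E 2 → (RungOne ⟺ PVPurification ∧ PVPureGame)`;
* UP THE LADDER: with the booked ladder items the two asides give the dim-4 step 28011 + the pencil pocket
  (`dimFour_of_pieces`, via `MaxContactCutTauLadder.closes_items`), the located core 28544 and its PURE-LOW₄ slice
  30702 (`pureLowDimFour_of_pieces`, via `MaxContactCutFedderCut`).  ROOT BY NAME is the route's own `closes`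
  (cone unchanged: … → StepPICoreImpure 30704 → StepPICorePure 30705 → `ResolutionOfSingularities`).
WHY THIS IS NOVEL (critic row 59): Fedder purity of the core point is a ONE-WAY VALVE of the weak order-reduction
game at marking 3 — forward-invariant under every weakly admissible blow-up (Cartier–Frobenius trace lift along
centres of codimension `≤ n + 1`), so the residual `Purification 3` is paid ONCE and the pure game is a closed
sub-game disjoint from every catalogued wild specimen.  Census data: HOME/CRITIC-LEDGER.md row 59; lens sha256
dd3d1f175e2a2a66.  (Sources: Fedder1983 Thm 1.12; LauritzenThomsen2011 Prop. 2.4, Lemma 2.12;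
CossartJannsenSaito2020 Thm 2.10; Kollar2007 Thm 3.75–3.76; CossartPiltant2019.)
-/

namespace Summit.ResolutionOfSingularities.ResolutionOfSingularities.Theorems.MaxContactCutPurityValve

open CategoryTheory AlgebraicGeometry
open Literature.AlgebraicGeometry.Resolution
open Summit.ResolutionOfSingularities.ResolutionOfSingularities.Theses
open Summit.ResolutionOfSingularities.ResolutionOfSingularities.Theorems
open WeakOrderReduction ForcedTowerClasses PurityValveClasses

/-! ## The asides unfolded -/

/-- `PVPureGame` is the family of pure games. [folklore] -/
theorem pvPureGame_iff : MaxContactCut.PVPureGame ↔ ∀ n : ℕ, 1 ≤ n → WORPure n := Iff.rfl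

/-- `PVPurification` is the family of purifications. [folklore] -/
theorem pvPurification_iff : MaxContactCut.PVPurification ↔ ∀ n : ℕ, 1 ≤ n → Purification n := Iff.rfl

/-! ## Down from the parents (necessity, modulo the costume `BaseStable`) -/

/-- `E 1` gives both asides (mod `BaseStable`). [folklore] -/
theorem pieces_of_e_one (hS : BaseStable) (h : E 1) : MaxContactCut.PVPureGame ∧ MaxContactCut.PVPurification :=
  PurityValveClasses.pieces_of_e_one hS h

/-- `WOR n` at one marking gives the three sequence-form pieces (mod `BaseStable`). [folklore] -/
theorem piecesAt_of_wor (hS : BaseStable) {n : ℕ} (h : WOR n) : WORPure n ∧ WORImpure n ∧ Purification n :=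
  PurityValveClasses.pieces_of_wor hS h

/-- `RungOne` (29273) gives both asides under `E 2` (mod `BaseStable`). [folklore] -/
theorem pieces_of_rungOne (hS : BaseStable) (h2 : E 2) (h : MaxContactCut.RungOne) :
    MaxContactCut.PVPureGame ∧ MaxContactCut.PVPurification :=
  pieces_of_e_one hS ((MaxContactCutForcedTowers.rungOne_iff_of_e_two h2).1 h)

/-! ## Up from the pieces -/

/-- PURIFY, THEN PLAY THE PURE GAME: the two asides give `E 1`. [folklore] -/
theorem e_one_of_pieces (hP : MaxContactCut.PVPurification) (hQ : MaxContactCut.PVPureGame) : E 1 :=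
  PurityValveClasses.e_one_of_pieces hP hQ

/-- **SEQUENCE LEDGER BY NAME**: the two asides settle `MaxContactCut.RungOne` (29273). [folklore] -/
theorem rungOne_of_pieces (hP : MaxContactCut.PVPurification) (hQ : MaxContactCut.PVPureGame) :
    MaxContactCut.RungOne :=
  MaxContactCutForcedTowers.rungOne_of_e_one (e_one_of_pieces hP hQ)

/-- **EXACT at the rung** (mod `BaseStable`, under `E 2`): `RungOne ⟺ PVPurification ∧ PVPureGame`. [folklore] -/
theorem rungOne_iff_pieces (hS : BaseStable) (h2 : E 2) :
    MaxContactCut.RungOne ↔ MaxContactCut.PVPurification ∧ MaxContactCut.PVPureGame :=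
  ⟨fun h => ⟨(pieces_of_rungOne hS h2 h).2, (pieces_of_rungOne hS h2 h).1⟩, fun h => rungOne_of_pieces h.1 h.2⟩

/-- **EXACT at every marking** (mod `BaseStable`): `E 1 ⟺ PVPurification ∧ PVPureGame`. [folklore] -/
theorem e_one_iff_pieces (hS : BaseStable) : E 1 ↔ MaxContactCut.PVPurification ∧ MaxContactCut.PVPureGame :=
  ⟨fun h => ⟨(pieces_of_e_one hS h).2, (pieces_of_e_one hS h).1⟩, fun h => e_one_of_pieces h.1 h.2⟩

/-- HONESTY KERNEL: modulo the pure game, the located residual IS `E 1` (mod `BaseStable`). [folklore] -/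
theorem purification_iff_e_one (hS : BaseStable) (hQ : MaxContactCut.PVPureGame) :
    MaxContactCut.PVPurification ↔ E 1 :=
  ⟨fun hP => e_one_of_pieces hP hQ, fun h => (pieces_of_e_one hS h).2⟩

/-- At markings `n ≥ 4` with `p ≤ n` the pure game is already the class-≥2 statement: a datum all of whose core
points are pure has NO core point (mod the definitional port `TauOneHyperplanar`). [folklore] -/
theorem pureGame_high_vacuous (hT : TauOneHyperplanar) {p : ℕ} {k : Type} [Field k] {Y : Scheme.{0}}
    (g : Y ⟶ Spec (.of k)) (hB : IsBase Y g) (I : Y.IdealSheafData) {n : ℕ} (hp : 2 ≤ p) (hpn : p ≤ n)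
    (hn : 4 ≤ n) (hall : AllCorePure p g hB.isRegular I n) (y : Y) : ¬ IsCorePt g hB.isRegular I n y :=
  (allCorePure_iff_no_core_high hT g hB I hp hpn hn).1 hall y

/-! ## Up the ladder BY NAME -/

/-- **DIM-4 LEDGER BY NAME**: with the booked ladder items the two asides give the whole dim-4 step 28011 and the
pencil pocket (`MaxContactCutTauLadder.closes_items`). [folklore] -/
theorem dimFour_of_pieces (hB : MaxContactCut.OrderBound) (h1 : MaxContactCut.LocalOrderOneResolveDimFour)
    (hM : MaxContactCut.MarkedThreefoldResolution) (hC : CossartJannsenSaito2020EmbeddedSequenceB.{0})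
    (hX : MaxContactCutExhaustion.ExhaustionBridge) (r4 : MaxContactCut.RungFour) (r3 : MaxContactCut.RungThree)
    (r2 : MaxContactCut.RungTwo) (hS : MaxContactCut.SequenceToStepAll) (hP : MaxContactCut.PVPurification)
    (hQ : MaxContactCut.PVPureGame) : MaxContactCut.StepDimFour ∧ OrderCut.PencilResolveDimFour :=
  MaxContactCutTauLadder.closes_items hB h1 hM hC hX r4 r3 r2 (rungOne_of_pieces hP hQ) hS

/-- … the located dim-4 core 28544 and its PURE-LOW₄ slice 30702 BY NAME. [folklore] -/
theorem pureLowDimFour_of_pieces (hB : MaxContactCut.OrderBound) (h1 : MaxContactCut.LocalOrderOneResolveDimFour)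
    (hM : MaxContactCut.MarkedThreefoldResolution) (hC : CossartJannsenSaito2020EmbeddedSequenceB.{0})
    (hX : MaxContactCutExhaustion.ExhaustionBridge) (r4 : MaxContactCut.RungFour) (r3 : MaxContactCut.RungThree)
    (r2 : MaxContactCut.RungTwo) (hS : MaxContactCut.SequenceToStepAll) (hP : MaxContactCut.PVPurification)
    (hQ : MaxContactCut.PVPureGame) : MaxContactCut.StepPICoreDimFour ∧ MaxContactCut.StepPICorePureLowDimFour :=
  have hK := MaxContactCutTauLadder.stepPICoreDimFour_of_stepDimFour
    (dimFour_of_pieces hB h1 hM hC hX r4 r3 r2 hS hP hQ).1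
  ⟨hK, MaxContactCutFedderCut.pureLowDimFour_of_pure (MaxContactCutFedderCut.pureDimFour_of_core hK)⟩

/-- The located core 28544 BY NAME from the two asides, lens-5's contact family and the rungs R4–R2
(`MaxContactCutTauLadder.closes`). [folklore] -/
theorem core_of_pieces (h5 : MaxContactCutExhaustion.ContactOrderSequenceDimFour) (r4 : MaxContactCut.RungFour)
    (r3 : MaxContactCut.RungThree) (r2 : MaxContactCut.RungTwo) (hP : MaxContactCut.PVPurification)
    (hQ : MaxContactCut.PVPureGame) (hSS : MaxContactCut.SequenceToStepAll) : MaxContactCut.StepPICoreDimFour :=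
  (MaxContactCutTauLadder.closes h5 r4 r3 r2 (rungOne_of_pieces hP hQ) hSS).2.2.2.2

/-- The root-cone items 30704 / 30705 are summit-implied (landed `MaxContactCutFedderCut`). [folklore] -/
theorem rootCone_of_summit (h : _root_.ResolutionOfSingularities) :
    MaxContactCut.StepPICoreImpure ∧ MaxContactCut.StepPICorePure :=
  ⟨MaxContactCutFedderCut.impure_of_summit h, MaxContactCutFedderCut.pure_of_summit h⟩

end Summit.ResolutionOfSingularities.ResolutionOfSingularities.Theorems.MaxContactCutPurityValve
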